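import Mathlib
import HarnessLib
import Literature.AlgebraicGeometry.Motives.AbelianVariety
import Literature.AlgebraicGeometry.HodgeTheory.HodgeConjecture
import Literature.AlgebraicGeometry.HodgeTheory.SemiregularityMap

/-!
# Crux-ideate sketch — `WittTowerStep` (stmt-HodgeConjecture-2523), ideator 3, round 1

First lemmas of the two idea cards filed from this seat:

* `compact-type-secant-ladder`  — §1: the tower collapses upward (Schoen 1998 §10 descent), so the
  crux is implied by Weil-class algebraicity on a COFINAL set of levels (e.g. the split components
  reached by Markman's secant anchors `J(C_g) × J(C_g)^`); pure logic, PROVED here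
  (`all_of_cofinal_descent`, `wittTowerStep_of_cofinal_descent`).
* `kunneth-sigma-aj-rigidity` — §2: the DEGREE-ONE semiregularity map
  `σ¹_k : Ext¹(F,F) → H^{k+1}(Ω^k)` (infinitesimal Abel–Jacobi / determinant map) on the tree's
  `AtiyahTraceAlgebra`, the predicate `IsAJRigid`, and the linear-algebra core of the product
  lemma (injectivity of a tensor product of linear maps over a field), stated.
-/

namespace Summit.HodgeConjecture.HodgeConjecture.Cruxes.WittTowerStep.IdeatorThree

open CategoryTheory

/-! ## §1  Upward collapse of the Witt tower -/

/-- The thesis at level `m` (Weil classes algebraic on Weil-type abelian `2m`-folds, all `K = ℚ(√-d)`,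
all discriminants) — literally the formula inlined twice in the route decl `WittTowerStep`. -/
def X (m : ℕ) : Prop :=
  ∀ (d : ℕ), 0 < d → ∀ (A : Literature.AlgebraicGeometry.Motives.AbelianVariety ℂ) (φ : A ⟶ A), A.dim = 2 * m → Literature.AlgebraicGeometry.Motives.IsSmoothProjective (2 * m) A.X → CategoryTheory.CategoryStruct.comp φ φ = -(d • CategoryTheory.CategoryStruct.id A) → ∀ c : Literature.AlgebraicTopology.SingularHomology.singularCohomology ℂ ℂ (Literature.AlgebraicGeometry.Motives.ComplexPoints A.X) (2 * m), Literature.AlgebraicGeometry.HodgeTheory.IsRationalClass c → Literature.AlgebraicGeometry.HodgeTheory.IsOfHodgeType (2 * m) A.X (2 * m) m m c → (∃ c₁ c₂ : Literature.AlgebraicTopology.SingularHomology.singularCohomology ℂ ℂ (Literature.AlgebraicGeometry.Motives.ComplexPoints A.X) (2 * m), c = c₁ + c₂ ∧ (∀ x y : ℕ, Literature.AlgebraicTopology.SingularHomology.singularCohomology.map ℂ ℂ (Literature.AlgebraicGeometry.Motives.AlgPoints.mapContinuous (L := ℂ) (x • CategoryTheory.CategoryStruct.id A + y • φ).hom.hom.hom)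 (2 * m) c₁ = ((x : ℂ) + (y : ℂ) * Complex.I * (Real.sqrt d : ℂ)) ^ (2 * m) • c₁) ∧ (∀ x y : ℕ, Literature.AlgebraicTopology.SingularHomology.singularCohomology.map ℂ ℂ (Literature.AlgebraicGeometry.Motives.AlgPoints.mapContinuous (L := ℂ) (x • CategoryTheory.CategoryStruct.id A + y • φ).hom.hom.hom) (2 * m) c₂ = ((x : ℂ) - (y : ℂ) * Complex.I * (Real.sqrt d : ℂ)) ^ (2 * m) • c₂)) → c ∈ Literature.AlgebraicGeometry.HodgeTheory.algebraicClasses A.X m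

/-- **Cofinal descent (pure logic).** If a predicate descends one step at every level `≥ 2`
(Schoen's transfer: `X (n+1) → X n`, by pairing with a Weil surface of the complementary
discriminant) and holds on a cofinal set of levels, it holds at every level `≥ 2`. -/
theorem all_of_cofinal_descent (P : ℕ → Prop) (hdown : ∀ n, 2 ≤ n → P (n + 1) → P n)
    (hcof : ∀ N : ℕ, ∃ m, N ≤ m ∧ P m) : ∀ n, 2 ≤ n → P n := by
  intro n hn
  obtain ⟨m, hnm, hm⟩ := hcof n
  have key : ∀ k : ℕ, ∀ n : ℕ, 2 ≤ n → n + k = m → P n := by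
    intro k
    induction k with
    | zero =>
      intro n _ h
      simp only [Nat.add_zero] at h
      subst h
      exact hm
    | succ k ih =>
      intro n hn h
      exact hdown n hn (ih (n + 1) (by omega) (by omega))
  exact key (m - n) n hn (by omega)

/-- **The crux from cofinality.** `WittTowerStep` (indeed the whole thesis) follows from
(i) Schoen's one-step descent at every level and (ii) the thesis on a COFINAL set of levels —
e.g. the levels at which a semiregular secant anchor exists on the split component, by
`X_split (n+1) → X n` (descent with discriminant steering). This is the re-indexing used by the
card `compact-type-secant-ladder`: climb only where anchors are, descend for free. -/
theorem wittTowerStep_of_cofinal_descent (hdown : ∀ n, 2 ≤ n → X (n + 1) → X n)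
    (hcof : ∀ N : ℕ, ∃ m, N ≤ m ∧ X m) :
    ∀ n : ℕ, 2 ≤ n → X n → X (n + 1) := by
  -- this is `Theses.TropicalCuspLift.WittTowerStep` with `X` folded (definitionally equal; the
  -- route module is not imported here because the route was retired during the session and the
  -- farm snapshot of that module is incoherent — the folder copy checked rc 0 WITH the import and
  -- the literal route decl as conclusion, attached as evidence `Sketch.lean` on the item)
  intro n hn _
  exact all_of_cofinal_descent X hdown hcof (n + 1) (by omega)

/-! ## §2  Degree-one semiregularity (`AJ-rigidity`) and the product lemma's linear core -/

section AJ

open Literature.AlgebraicGeometry.HodgeTheory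

universe u v

variable {𝕜 : Type u} [CommRing 𝕜]

/-- The **degree-one semiregularity map** `σ¹_k : Ext¹_X(F,F) → H^{k+1}(X, Ω^k)`,
`σ¹_k(x) = ((-1)^k/k!) Tr(x · At^k(F))` — the differential of the determinant map (`k = 0`,
`Ext¹ → H¹(𝒪)`) and of the Abel–Jacobi-type maps of the deformation space of `F` (`k ≥ 1`).
Same formula as the tree's `semiregularityComponent`, one Ext-degree lower
(Buchweitz–Flenner define `σ` on every `Ext^i`). -/
noncomputable def sigmaOne (A : AtiyahTraceAlgebra.{u, v} 𝕜) (k : ℕ) : A.Ext 1 0 →ₗ[𝕜] A.Coh (k + 1) k :=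
  (AtiyahTraceAlgebra.expCoeff k : 𝕜) •
    (A.trace (k + 1) k ∘ₗ (A.mul (Nat.add_comm 1 k) (Nat.zero_add k)).flip (A.atiyahPow k))

/-- **`F` is AJ-rigid** (= `1`-semiregular in Ext-degree one): `σ¹ = (σ¹_k)_k` is injective on
`Ext¹_X(F,F)`, i.e. every first-order deformation of `F` on the fixed `X` moves its
determinant / Abel–Jacobi invariants. This is the extra hypothesis that makes semiregularity
hereditary under exterior products (card `kunneth-sigma-aj-rigidity`, product lemma). -/
def IsAJRigid (A : AtiyahTraceAlgebra.{u, v} 𝕜) : Prop :=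
  Function.Injective (LinearMap.pi (sigmaOne A))

end AJ

/-- **Linear core of the product lemma (the `(1,1)`-Künneth block).** Over a field, for non-zero
spaces, `f ⊗ g` is injective iff `f` and `g` are: applied to `f = σ¹(E₁)`, `g = σ¹(E₂)` this is
"the mixed block `Ext¹(E₁,E₁) ⊗ Ext¹(E₂,E₂)` of `Ext²(E₁ ⊠ E₂)` is detected by `σ(E₁ ⊠ E₂)` iff both
factors are AJ-rigid". Stated (standard linear algebra; to be cited from Mathlib or proved with
bases). -/
theorem tensor_map_injective_iff {K : Type*} [Field K] {V₁ W₁ V₂ W₂ : Type*}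
    [AddCommGroup V₁] [Module K V₁] [AddCommGroup W₁] [Module K W₁]
    [AddCommGroup V₂] [Module K V₂] [AddCommGroup W₂] [Module K W₂]
    [Nontrivial V₁] [Nontrivial V₂] (f : V₁ →ₗ[K] W₁) (g : V₂ →ₗ[K] W₂) :
    Function.Injective (TensorProduct.map f g) ↔ Function.Injective f ∧ Function.Injective g := by
  sorry

end Summit.HodgeConjecture.HodgeConjecture.Cruxes.WittTowerStep.IdeatorThree
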